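import Summits.QuantumFields.BalabanUV.T4Continuum.Spine.NE9.DirectPairingApex

/-!
# T⁴ programme, spine estimate NE9 — KING'S CURRENCY THROUGH NODE U5's DESIGN (i): weights (NE7b) + shells (NE7c) + good-class cores, the
# cell's `HybridNE7` field by field with ONLY the field `summable : Summable δ` replaced by `δ_K → 0` (and the data supplied for every pair
# (K, K + n)) ⇒ King's matching ⇒ node U6 ⇒ `StringwiseGenFunCauchy` — census item C38c of cell `pub-balaban-gaps`, seat ne9 (gen 10)

Cell `pub-balaban-gaps` (YM blitz G2, seat ne9, unit `pub-balaban-gaps-ne9-g10`; record `run/shared/lean/pub/pub-balaban-gaps/ne/NE9.md`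
§5 row C38c).  Summits-side bookkeeping over the tree's node-U5 design (i) (`T4WeightBudget.RelWeightBound` = NE7b's output shape,
`T4IndicatorShell.ShellWeightBound` = NE7c's output shape, the refined families `refT` ∕ `refVal` ∕ `refBad`, `relWeightBound_ref`, `good_ref`,
`T4WeightBudget.hybridSandwich_of_relWeightBound`) and this seat's `DirectPairingApex` (census C38).  NO definition; nothing of Bałaban's asserted.

WHY.  `DirectPairingApex.kingMatching_of_hybridSandwich` (C38) took the per-pair `HybridSandwich` as its hypothesis.  The cell's node U5 is one
level more structured: `T4MatchingAssembly.HybridNE7` = {`weight : RelWeightBound` (NE7b, both runs), `shell : ShellWeightBound` (NE7c),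
`lt_one`, `summable : Summable δ` (node U4′), `core` (NE7's term-wise half on the good classes, width `vol·δ K`)}, assembled by
`T4IndicatorShell.cauchy_of_relWeightBound_shell`.  This file shows WHICH FIELD King's organisation deletes: exactly `summable`.  With the SAME
weight ∕ shell ∕ lt_one ∕ core clauses supplied for every pair (K, K + n) — bad weights `W K`, shell weights `Wsh K` and core width `vol·δ K` independent
of `n` — and `δ_K → 0` in place of `Summable δ`:
* §1 `kingMatching_of_design`: King's matching `|log Z_{K+n}(t) − log Z_K(t) − c_{K,n}| ≤ vol·hybridDelta vol δ (W + Wsh) K` (the refined families of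
  `T4IndicatorShell` fed to `kingMatching_of_hybridSandwich`; the tree's `relWeightBound_ref`, `good_ref`, `hybridSandwich_of_relWeightBound` BY NAME);
  `cauchy_of_design`: `δ → 0` (+ the weights' own summability, which gives `W + Wsh → 0`) ⇒ every generating function Cauchy + uniform convergence on
  the `l₀`-ball — compare `cauchy_of_relWeightBound_shell` (consecutive, `Summable δ`).
* §2 (scheme level) `stringwiseGenFunCauchy_of_design`: per string of a scheme with `β_K ≥ 0` and measurable observables bounded by `1`, design-(i) data
  for every pair from an offset `K₀` on ⇒ `T4ApexHybrid.StringwiseGenFunCauchy S` (positivity discharged by `T4GenFunBounds.dressedZ_pos`; then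
  `DirectPairingApex.stringwiseGenFunCauchy_of_king`), hence `HasContinuumLimit` and — under the prefix — `ContinuumYM4Torus` by
  `DirectPairingApex.continuumYM4Torus_of_kingUnder`.

VERDICT FOR THE ROW (census C38c): in King's organisation node U5 is the cell's `HybridNE7` with `summable : Summable δ` replaced by `Tendsto δ atTop (𝓝 0)`
and the fields supplied per pair (K, K + n); nothing else of design (i) changes.  HONEST RESIDUE: the per-pair weight ∕ shell ∕ core PRODUCERS for runs `n`
apart (NE7b ∕ NE7c ∕ the term-wise two-run rates of `T4MatchingClosure*`, restated n-uniformly) — the T4-DAG owner's modules; instance 0∕1.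
CLASSIFICATION OF NE9 UNCHANGED: WORK-bound (W1).

HONEST FRAMING: bookkeeping for rung (B)+1 on ONE FIXED finite four-torus; every clause below is a hypothesis SHAPE (NE7b, NE7c, NE7's cores — the cell's
located new estimates, none in print for Bałaban's d = 4 procedure); NE9 NOT PRINTED ∕ NOT PROVED; spine PROVED 0∕9 unchanged; NOT UV stability, NOT
the continuum limit, NOT infinite volume, NOT a mass gap, NOT Clay.  HONEST DEPENDENCY: continuum YM on T⁴ ⇐ BetaPertH ∧ nine spine estimates (0∕9
proved); BetaPertH ⇐ (D1) ∧ (D4) ∧ CAP+tail.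

References (TYPES only): [King1986] = C. King, Commun. Math. Phys. **102** (1986) 649–677, Thm 3.4 (3.9) p. 656, (3.10)–(3.13) pp. 656–657.
-/

namespace Summit.QuantumFields.BalabanUV.T4Continuum.NE9.DirectPairingApexDesign

open scoped BigOperators
open Finset Filter Topology
open Literature.MathematicalPhysics.QuantumFieldTheory.Balaban1983to89
open T4CauchySum (genFun genFunLim)
open T4HybridMatching (HybridSandwich hybridDelta)
open T4WeightBudget (RelWeightBound hybridSandwich_of_relWeightBound)
open T4IndicatorShell (ShellWeightBound refT refVal refBad sum_refT_refVal refVal_nonneg relWeightBound_ref good_ref)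
open Missing (TorusScheme HasContinuumLimit)
open Summit.QuantumFields.BalabanUV.T4Continuum.NE9.DirectPairingApex
  (tendsto_hybridDelta kingMatching_of_hybridSandwich stringwiseGenFunCauchy_of_king)
open Summit.QuantumFields.BalabanUV.T4Continuum.NE9.DirectPairingCauchy
  (cauchySeq_genFun_of_unif tendstoUniformlyOn_genFun_of_unif)

/-! ## §1 Design (i) per pair (K, K + n), n-uniform weights ∕ shells ∕ core widths, `δ → 0` ⇒ King's matching ⇒ node U6 -/

section Pair

variable {ι : Type*} [DecidableEq ι] {l₀ vol : ℝ} {W Wsh δ : ℕ → ℝ} {Z : ℕ → ℝ → ℝ}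

/-- **KING'S MATCHING FROM DESIGN (i), FIELD BY FIELD.**  For every `n` let the pair (run A = `K` steps, run B = `K + n` steps; the index `K` inside
the families) carry NE7b's output `RelWeightBound l₀ (T n) (A n) (B n) (Bad n) W`, NE7c's output `ShellWeightBound l₀ (T n) (A n) (B n) (shA n) (shB n)
Wsh` (weights `W`, `Wsh` INDEPENDENT of `n`), `W K + Wsh K < 1`, the dictionary `Z K = Σ A n K`, `Z (K + n) = Σ B n K` on `|t| ≤ l₀` with positive
totals, and NE7's term-wise half on the good classes with a `t`- and class-independent constant and width `vol·δ K` (independent of `n`).  Then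
`|log Z_{K+n}(t) − log Z_K(t) − c_{K,n}| ≤ vol·hybridDelta vol δ (W + Wsh) K` for all `K`, `n` — the refined families of `T4IndicatorShell`
(`relWeightBound_ref`, `good_ref`) through `hybridSandwich_of_relWeightBound` and `DirectPairingApex.kingMatching_of_hybridSandwich`, all BY NAME.
NO `Summable δ`. [cite: King1986, Thm 3.4 (3.9) p. 656] [folklore] -/
theorem kingMatching_of_design (hvol : 0 < vol) (T : ℕ → ℕ → Finset ι) (A B shA shB : ℕ → ℕ → ℝ → ι → ℝ)
    (Bad : ℕ → ℕ → ℝ → Finset ι)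
    (hW : ∀ n, RelWeightBound l₀ (T n) (A n) (B n) (Bad n) W)
    (hSh : ∀ n, ShellWeightBound l₀ (T n) (A n) (B n) (shA n) (shB n) Wsh) (hlt : ∀ K, W K + Wsh K < 1)
    (hZA : ∀ n K t, |t| ≤ l₀ → Z K t = ∑ τ ∈ T n K, A n K t τ)
    (hZB : ∀ n K t, |t| ≤ l₀ → Z (K + n) t = ∑ τ ∈ T n K, B n K t τ)
    (hpos : ∀ n K t, |t| ≤ l₀ → 0 < ∑ τ ∈ T n K, A n K t τ)
    (hcore : ∀ n K : ℕ, ∃ c : ℝ, ∀ t : ℝ, |t| ≤ l₀ → ∀ τ ∈ T n K \ Bad n K t,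
      Real.exp (c - vol * δ K) * (A n K t τ - shA n K t τ) ≤ B n K t τ - shB n K t τ ∧
        B n K t τ - shB n K t τ ≤ Real.exp (c + vol * δ K) * (A n K t τ - shA n K t τ)) :
    ∀ K n : ℕ, ∃ c : ℝ, ∀ t : ℝ, |t| ≤ l₀ →
      |Real.log (Z (K + n) t) - Real.log (Z K t) - c| ≤ vol * hybridDelta vol δ (fun K => W K + Wsh K) K := by
  -- refined families, indexed as (K, n) for `kingMatching_of_hybridSandwich`
  refine kingMatching_of_hybridSandwich (δ := δ) (W := fun K => W K + Wsh K) hvol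
    (fun K n => refT (T n) K) (fun K n t => refVal (A n) (shA n) K t) (fun K n t => refVal (B n) (shB n) K t)
    (fun K n t ht => by rw [sum_refT_refVal]; exact hZA n K t ht)
    (fun K n t ht => by rw [sum_refT_refVal]; exact hZB n K t ht) hlt
    (fun K n t ht => by rw [sum_refT_refVal]; exact hpos n K t ht) fun K n => ?_
  have hA' : ∀ K t, |t| ≤ l₀ → ∀ x ∈ refT (T n) K, 0 ≤ refVal (A n) (shA n) K t x := fun K t ht =>
    refVal_nonneg ((hSh n).sh_nonneg_left K t ht) ((hSh n).sh_le_left K t ht)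
  have hB' : ∀ K t, |t| ≤ l₀ → ∀ x ∈ refT (T n) K, 0 ≤ refVal (B n) (shB n) K t x := fun K t ht =>
    refVal_nonneg ((hSh n).sh_nonneg_right K t ht) ((hSh n).sh_le_right K t ht)
  obtain ⟨c, hc⟩ := hybridSandwich_of_relWeightBound (relWeightBound_ref (hW n) (hSh n) hlt) hA' hB' (good_ref (hcore n)) K
  exact ⟨c, fun t ht => by
    obtain ⟨Gd, hG⟩ := hc t ht
    exact ⟨Gd, hG⟩⟩

/-- **NODE U6 FROM DESIGN (i) IN KING'S ORGANISATION — the field `summable : Summable δ` replaced by `δ_K → 0`.**  Under the hypotheses of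
`kingMatching_of_design`, `0 ≤ l₀` and `Tendsto δ atTop (𝓝 0)`: every generating function `K ↦ genFun Z K t`, `|t| ≤ l₀`, is Cauchy and the
convergence to `genFunLim Z` is uniform on the closed `l₀`-ball.  (The weights' summability — fields of `RelWeightBound` ∕ `ShellWeightBound`, NE7b ∕
NE7c — gives `W + Wsh → 0`; it is the CORE remainder that is freed from ℓ¹.)  Compare `T4IndicatorShell.cauchy_of_relWeightBound_shell`.
[cite: King1986, p. 657] [folklore] -/
theorem cauchy_of_design (hvol : 0 < vol) (hl₀ : 0 ≤ l₀) (T : ℕ → ℕ → Finset ι) (A B shA shB : ℕ → ℕ → ℝ → ι → ℝ)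
    (Bad : ℕ → ℕ → ℝ → Finset ι)
    (hW : ∀ n, RelWeightBound l₀ (T n) (A n) (B n) (Bad n) W)
    (hSh : ∀ n, ShellWeightBound l₀ (T n) (A n) (B n) (shA n) (shB n) Wsh) (hlt : ∀ K, W K + Wsh K < 1)
    (hZA : ∀ n K t, |t| ≤ l₀ → Z K t = ∑ τ ∈ T n K, A n K t τ)
    (hZB : ∀ n K t, |t| ≤ l₀ → Z (K + n) t = ∑ τ ∈ T n K, B n K t τ)
    (hpos : ∀ n K t, |t| ≤ l₀ → 0 < ∑ τ ∈ T n K, A n K t τ) (hδ : Tendsto δ atTop (𝓝 0))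
    (hcore : ∀ n K : ℕ, ∃ c : ℝ, ∀ t : ℝ, |t| ≤ l₀ → ∀ τ ∈ T n K \ Bad n K t,
      Real.exp (c - vol * δ K) * (A n K t τ - shA n K t τ) ≤ B n K t τ - shB n K t τ ∧
        B n K t τ - shB n K t τ ≤ Real.exp (c + vol * δ K) * (A n K t τ - shA n K t τ)) :
    (∀ t : ℝ, |t| ≤ l₀ → CauchySeq fun K => genFun Z K t) ∧
      TendstoUniformlyOn (fun K t => genFun Z K t) (genFunLim Z) atTop {t | |t| ≤ l₀} := by
  have hK := kingMatching_of_design hvol T A B shA shB Bad hW hSh hlt hZA hZB hpos hcore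
  have hWs : Tendsto (fun K => W K + Wsh K) atTop (𝓝 0) := by
    simpa using ((hW 0).summable.add (hSh 0).summable).tendsto_atTop_zero
  have hΔ : Tendsto (hybridDelta vol δ fun K => W K + Wsh K) atTop (𝓝 0) := tendsto_hybridDelta hδ hWs
  exact ⟨fun t ht => cauchySeq_genFun_of_unif hK hl₀ hΔ ht, tendstoUniformlyOn_genFun_of_unif hK hl₀ hΔ⟩

end Pair

/-! ## §2 Scheme level: design-(i) data per string and pair ⇒ `StringwiseGenFunCauchy` (⇒ `HasContinuumLimit` ⇒ `ContinuumYM4Torus`) -/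

section Scheme

variable {G : Type*} [GaugeGroup G] [MeasurableSpace G] [RegularGaugeGroup G] [HaarData G] {O : Type*}

/-- **PER STRING: DESIGN (i) FOR EVERY PAIR FROM AN OFFSET `K₀` ON, `δ → 0` ⇒ `StringwiseGenFunCauchy S`** for a scheme with `β_K ≥ 0` and measurable
observables bounded by `1` (positivity of the dressed partition functions DISCHARGED by `T4GenFunBounds.dressedZ_pos`; then `kingMatching_of_design` and
`DirectPairingApex.stringwiseGenFunCauchy_of_king`).  From here `HasContinuumLimit S` (`DirectPairingApex.hasContinuumLimit_of_king`) and, under the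
targets' prefix, `ContinuumYM4Torus D` (`DirectPairingApex.continuumYM4Torus_of_kingUnder`).  Compare the consecutive `T4MatchingAssembly.StringHybridNE7`
⇒ `matchingModConstants_schemeZ`. [folklore] -/
theorem stringwiseGenFunCauchy_of_design (S : TorusScheme G O) (hβ : ∀ K, 0 ≤ S.β K)
    (hm : ∀ K o, Measurable (S.obs K o)) (h1 : ∀ K o U, |S.obs K o U| ≤ 1)
    (hD : ∀ os : List O, ∃ (l₀ vol : ℝ) (K₀ : ℕ), 0 < l₀ ∧ 0 < vol ∧
      ∃ (ι : Type) (_ : DecidableEq ι) (T : ℕ → ℕ → Finset ι) (A B shA shB : ℕ → ℕ → ℝ → ι → ℝ)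
        (Bad : ℕ → ℕ → ℝ → Finset ι) (W Wsh δ : ℕ → ℝ),
        (∀ n, RelWeightBound l₀ (T n) (A n) (B n) (Bad n) W) ∧
        (∀ n, ShellWeightBound l₀ (T n) (A n) (B n) (shA n) (shB n) Wsh) ∧ (∀ K, W K + Wsh K < 1) ∧
        Tendsto δ atTop (𝓝 0) ∧
        (∀ n K t, |t| ≤ l₀ → T4GenFunBounds.schemeZ S os (K₀ + K) t = ∑ τ ∈ T n K, A n K t τ) ∧
        (∀ n K t, |t| ≤ l₀ → T4GenFunBounds.schemeZ S os (K₀ + (K + n)) t = ∑ τ ∈ T n K, B n K t τ) ∧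
        ∀ n K : ℕ, ∃ c : ℝ, ∀ t : ℝ, |t| ≤ l₀ → ∀ τ ∈ T n K \ Bad n K t,
          Real.exp (c - vol * δ K) * (A n K t τ - shA n K t τ) ≤ B n K t τ - shB n K t τ ∧
            B n K t τ - shB n K t τ ≤ Real.exp (c + vol * δ K) * (A n K t τ - shA n K t τ)) :
    T4ApexHybrid.StringwiseGenFunCauchy S := by
  refine stringwiseGenFunCauchy_of_king S fun os => ?_
  obtain ⟨l₀, vol, K₀, hl₀, hvol, ι, _, T, A, B, shA, shB, Bad, W, Wsh, δ, hW, hSh, hlt, hδ, hZA, hZB, hcore⟩ := hD os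
  have hpos : ∀ n K t, |t| ≤ l₀ → 0 < ∑ τ ∈ T n K, A n K t τ := fun n K t ht => by
    rw [← hZA n K t ht]
    unfold T4GenFunBounds.schemeZ
    exact T4GenFunBounds.dressedZ_pos (S.P (K₀ + K)) (hβ (K₀ + K))
      (T4GenFunBounds.measurable_prodObs S hm (K₀ + K) os) (T4GenFunBounds.abs_prodObs_le_one S h1 (K₀ + K) os) t
  have hWs : Tendsto (fun K => W K + Wsh K) atTop (𝓝 0) := by
    simpa using ((hW 0).summable.add (hSh 0).summable).tendsto_atTop_zero
  exact ⟨l₀, vol, K₀, hybridDelta vol δ fun K => W K + Wsh K, hl₀, tendsto_hybridDelta hδ hWs,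
    kingMatching_of_design (Z := fun K => T4GenFunBounds.schemeZ S os (K₀ + K)) hvol T A B shA shB Bad hW hSh hlt hZA hZB
      hpos hcore⟩

end Scheme

end Summit.QuantumFields.BalabanUV.T4Continuum.NE9.DirectPairingApexDesign
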